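import Literature.AlgebraicGeometry.Motives.HodgeLieWeightOneSl2CenterSplitting
import HarnessLib

/-!
# Weight-one Hodge structures whose Hodge Lie algebra contains a three-dimensional IDEAL `𝔞`.
# A: `E, F ∈ 𝔞_ℂ`, `𝔞_ℂ = ℂE ⊕ ℂF ⊕ ℂ[E, F]`, and `𝔞_ℂ` has trivial centraliser in itself

Family `hodge`, layer `Literature/AlgebraicGeometry/Motives`; THEOREMS ONLY (no definition, no named fact; D-0026).
First abstract file of the lane MT-RANK-SEVEN-SPLIT of the cell `pub-hodgecm2` (COR-CM), seat `b27`: the analogue, for a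
pair of commuting NON-ABELIAN ideals `𝔞 ⊕ 𝔟` of `𝔥 = Lie Hg(H)` (semisimple rank two, `Hg = Hg₁ · Hg₂` with both factors
of type `SL₂`), of the lane MT-RANK-SIX-ISOGENY (`Motives/HodgeLieWeightOneSl2Center{,Commutator,Splitting,…}`, where the
complement of the three-dimensional derived algebra `𝔡` is the CENTRE `𝔷`).

SETTING.  `H` a polarizable `ℚ`-Hodge structure of weight `1` on a finite-dimensional `V` with polarization `ψ`, `e` a
graded basis with degrees in `{0,1}`, `P = gradingEnd e deg` the projector onto `V^{1,0}` (so the Hodge operator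
`2P − 1 ∈ 𝔥_ℂ`), `𝔥 = H.hodgeLie`, `𝔥_ℂ = H.hodgeLieC = spanC 𝔥`; `𝔞 ≤ 𝔥` a rational subspace which is an IDEAL
(`[𝔥, 𝔞] ⊆ 𝔞`), `X ∈ 𝔞 ∖ End_Hdg(V)`, `E = P X_ℂ (1 − P)`, `F = (1 − P) X_ℂ P`, and (§2) `dim_ℚ 𝔞 = 3`.

* §0 bookkeeping: `[𝔥_ℂ, 𝔞_ℂ] ⊆ 𝔞_ℂ` (`bracket_mem_spanC_of_ideal`), elementwise commutation passes to complex spans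
  (`commute_of_mem_spanC_of_commute`).
* §1 `projE_mem_spanC_of_ideal` — **`E, F ∈ 𝔞_ℂ`**: ideals are stable under `[P, ·] = ½[2P − 1, ·]`, and
  `2E = [P, X_ℂ] + [P, [P, X_ℂ]]`, `2F = [P, [P, X_ℂ]] − [P, X_ℂ]` (Deligne I 3.4: `ad μ` has weights `0, ±1`).
* §2 `exists_coeffs_of_mem_spanC_ideal` — **`𝔞_ℂ = ℂE ⊕ ℂF ⊕ ℂ[E, F]`** for `dim_ℚ 𝔞 = 3`;
  `eq_zero_of_mem_spanC_ideal_of_commute` — an element of `𝔞_ℂ` commuting with `E` and `F` vanishes once `EFE = αE`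
  with `α ≠ 0`.
* The sequel `Motives/HodgeLieWeightOneIdealPairComponent` (§3–§4) extracts the `𝔞`-component `α⁻¹[E, F]` of the Hodge
  operator `2P − 1 ∈ 𝔥_ℂ ⊆ 𝔞_ℂ + 𝔟_ℂ` for a commuting complement `𝔟` (`E F E = αE`, `F E F = αF` — the weight-one shortcut
  replacing the Casimir / string analysis of an `𝔰𝔩₂ × 𝔰𝔩₂`-module) and the projector `π = α⁻¹(EF + FE)`.

The file `Motives/HodgeLieWeightOneIdealPairSplitting` then runs this for both members of a pair `(𝔞, 𝔟)` of
three-dimensional ideals, proves `π_𝔞 + π_𝔟 = 1`, `𝔟_ℂ π_𝔞 = 0`, and descends `π_𝔞` to a rational central Hodge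
idempotent.  Classically (Moonen–Zarhin 1999 §3 (3.1), Cor. (3.7) after Imai; Deligne LNM 900 I §3): `Hg = Hg₁ × Hg₂` with
`Hgᵢ` forms of `SL₂`, `V = V₁ ⊕ V₂` with `Hgᵢ` acting on `Vᵢ` through the standard representation — pairs of
non-isogenous elliptic curves without complex multiplication, or of quaternion surfaces.

## References

* [MoonenZarhin1999LowDim] B. Moonen, Yu. Zarhin, *Hodge classes on abelian varieties of low dimension*, Math. Ann. 315
  (1999), §2 (Hodge group, reductivity, `End⁰(X) = End_{Hg} H¹`), §3 (3.1) and Cor. (3.7).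
* [Deligne1982HodgeCycles] P. Deligne, *Hodge cycles on abelian varieties*, LNM 900 (1982), I §3 (3.1–3.6).
* [FultonHarris1991] W. Fulton, J. Harris, *Representation Theory*, GTM 129 (1991), Lecture 11 (§11.1), §9.3.
-/

noncomputable section

open scoped TensorProduct

namespace Literature.AlgebraicGeometry.Motives

universe u

namespace HodgeStructure

open ProjectorBlocks Literature.RepresentationTheory.GeneralLinear

variable {V : Type u} [AddCommGroup V] [Module ℚ V] [Module.Finite ℚ V] [HodgeTensorFacts.{u, u}] {n : ℤ}
  {S : Type u} [Fintype S] [DecidableEq S] {deg : S → ℤ}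

/-! ## §0 Bookkeeping: ideals and commuting subspaces under complexification -/

omit [Module.Finite ℚ V] [HodgeTensorFacts.{u, u}] in
/-- **Brackets with `𝔞_ℂ` stay in `𝔞_ℂ`**: if `[Z, X] ∈ 𝔞` for all `Z ∈ 𝔤`, `X ∈ 𝔞` (a rational ideal condition), then
`W Z' − Z' W ∈ 𝔞_ℂ` for all `W ∈ 𝔤_ℂ`, `Z' ∈ 𝔞_ℂ` (bilinearity). [cite: FultonHarris1991, §9.3] -/
theorem bracket_mem_spanC_of_ideal {𝔤 𝔞 : Submodule ℚ (Module.End ℚ V)}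
    (hI : ∀ Z ∈ 𝔤, ∀ X ∈ 𝔞, Z * X - X * Z ∈ 𝔞) {W : Module.End ℂ (ℂ ⊗[ℚ] V)} (hW : W ∈ spanC 𝔤)
    {Z' : Module.End ℂ (ℂ ⊗[ℚ] V)} (hZ' : Z' ∈ spanC 𝔞) : W * Z' - Z' * W ∈ spanC 𝔞 := by
  unfold spanC at hW hZ' ⊢
  induction hW using Submodule.span_induction generalizing Z' with
  | mem W₀ hW₀ =>
    obtain ⟨Z, hZ, rfl⟩ := hW₀
    induction hZ' using Submodule.span_induction with
    | mem Z₀ hZ₀ =>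
      obtain ⟨X, hX, rfl⟩ := hZ₀
      have h := hI Z hZ X hX
      have h' : (Z * X - X * Z).baseChange ℂ ∈
          Submodule.span ℂ ((fun X : Module.End ℚ V => X.baseChange ℂ) '' (𝔞 : Set (Module.End ℚ V))) :=
        Submodule.subset_span ⟨_, h, rfl⟩
      rwa [LinearMap.baseChange_sub, LinearMap.baseChange_mul, LinearMap.baseChange_mul] at h'
    | zero => rw [mul_zero, zero_mul, sub_self]; exact Submodule.zero_mem _
    | add x y _ _ hx hy =>
      have : Z.baseChange ℂ * (x + y) - (x + y) * Z.baseChange ℂ =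
          (Z.baseChange ℂ * x - x * Z.baseChange ℂ) + (Z.baseChange ℂ * y - y * Z.baseChange ℂ) := by
        rw [mul_add, add_mul]; abel
      rw [this]; exact Submodule.add_mem _ hx hy
    | smul c x _ hx =>
      rw [mul_smul_comm, smul_mul_assoc, ← smul_sub]; exact Submodule.smul_mem _ c hx
  | zero => rw [zero_mul, mul_zero, sub_self]; exact Submodule.zero_mem _
  | add x y _ _ hx hy =>
    have : (x + y) * Z' - Z' * (x + y) = (x * Z' - Z' * x) + (y * Z' - Z' * y) := by rw [add_mul, mul_add]; abel
    rw [this]; exact Submodule.add_mem _ (hx hZ') (hy hZ')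
  | smul c x _ hx =>
    rw [smul_mul_assoc, mul_smul_comm, ← smul_sub]; exact Submodule.smul_mem _ c (hx hZ')

omit [Module.Finite ℚ V] [HodgeTensorFacts.{u, u}] in
/-- **Elementwise commutation passes to the complex spans**: if `X Y = Y X` for `X ∈ 𝔞`, `Y ∈ 𝔟`, then `A B = B A` for
`A ∈ 𝔞_ℂ`, `B ∈ 𝔟_ℂ`. [cite: FultonHarris1991, §9.3] -/
theorem commute_of_mem_spanC_of_commute {𝔞 𝔟 : Submodule ℚ (Module.End ℚ V)}
    (hcomm : ∀ X ∈ 𝔞, ∀ Y ∈ 𝔟, X * Y = Y * X) {A : Module.End ℂ (ℂ ⊗[ℚ] V)} (hA : A ∈ spanC 𝔞)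
    {B : Module.End ℂ (ℂ ⊗[ℚ] V)} (hB : B ∈ spanC 𝔟) : A * B = B * A := by
  unfold spanC at hA hB
  induction hA using Submodule.span_induction generalizing B with
  | mem A₀ hA₀ =>
    obtain ⟨X, hX, rfl⟩ := hA₀
    induction hB using Submodule.span_induction with
    | mem B₀ hB₀ =>
      obtain ⟨Y, hY, rfl⟩ := hB₀
      rw [← LinearMap.baseChange_mul, ← LinearMap.baseChange_mul, hcomm X hX Y hY]
    | zero => rw [mul_zero, zero_mul]
    | add x y _ _ hx hy => rw [mul_add, add_mul, hx, hy]
    | smul c x _ hx => rw [mul_smul_comm, smul_mul_assoc, hx]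
  | zero => rw [zero_mul, mul_zero]
  | add x y _ _ hx hy => rw [add_mul, mul_add, hx hB, hy hB]
  | smul c x _ hx => rw [smul_mul_assoc, mul_smul_comm, hx hB]

omit [Module.Finite ℚ V] [HodgeTensorFacts.{u, u}] in
/-- `spanC` is monotone. [cite: Deligne1982HodgeCycles, I §3 (proof of Prop. 3.4)] -/
theorem spanC_mono {𝔞 𝔟 : Submodule ℚ (Module.End ℚ V)} (h : 𝔞 ≤ 𝔟) : spanC 𝔞 ≤ spanC 𝔟 := by
  unfold spanC
  exact Submodule.span_mono (Set.image_mono h)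

/-! ## §1 `E, F ∈ 𝔞_ℂ` for an ideal `𝔞` of `𝔥` -/

/-- **`E = P X_ℂ (1−P)` and `F = (1−P) X_ℂ P` lie in `𝔞_ℂ`** for `X` in an IDEAL `𝔞` of `𝔥 = Lie Hg(H)` (weight `1`,
degrees in `{0,1}`): `[P, ·] = ½ [2P − 1, ·]` maps `𝔞_ℂ` into itself because `2P − 1 ∈ 𝔥_ℂ`, and
`2E = [P, X_ℂ] + [P, [P, X_ℂ]]`, `2F = [P, [P, X_ℂ]] − [P, X_ℂ]`.
[cite: Deligne1982HodgeCycles, I §3 (proof of Prop. 3.4)] [cite: FultonHarris1991, Lecture 11 (§11.1)] -/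
theorem projE_mem_spanC_of_ideal (H : HodgeStructure V n) (hn : n = 1) (e : Module.Basis S ℂ (ℂ ⊗[ℚ] V))
    (hF : ∀ a, H.F a = Submodule.span ℂ (e '' {σ | a ≤ deg σ}))
    (hFc : ∀ a, complexConj (H.F a) = Submodule.span ℂ (e '' {σ | deg σ ≤ n - a}))
    (hdeg : ∀ σ, deg σ = 0 ∨ deg σ = 1) {𝔞 : Submodule ℚ (Module.End ℚ V)}
    (hI : ∀ Z ∈ H.hodgeLie, ∀ X ∈ 𝔞, Z * X - X * Z ∈ 𝔞) {X : Module.End ℚ V} (hX : X ∈ 𝔞) :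
    gradingEnd e deg * X.baseChange ℂ * (1 - gradingEnd e deg) ∈ spanC 𝔞 ∧
      (1 - gradingEnd e deg) * X.baseChange ℂ * gradingEnd e deg ∈ spanC 𝔞 := by
  subst hn
  set P := gradingEnd e deg with hP
  set Y := X.baseChange ℂ with hY
  set E := P * Y * (1 - P) with hEdef
  set F := (1 - P) * Y * P with hFdef
  have hPP : P * P = P := gradingEnd_mul_gradingEnd_of_deg e hdeg
  have hPE : P * E = E := by rw [hEdef, ← mul_assoc, ← mul_assoc, hPP]
  have hEP : E * P = 0 := by rw [hEdef, mul_assoc (P * Y) (1 - P) P, sub_mul, one_mul, hPP, sub_self, mul_zero]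
  have hPF : P * F = 0 := by
    rw [hFdef, mul_assoc (1 - P) Y P, ← mul_assoc P (1 - P) (Y * P), mul_sub, mul_one, hPP, sub_self, zero_mul]
  have hFP : F * P = F := by rw [hFdef, mul_assoc ((1 - P) * Y) P P, hPP]
  have hΘ' : (2 : ℂ) • P - 1 ∈ H.hodgeLieC := by
    simpa only [Int.cast_one, one_smul] using two_smul_gradingEnd_sub_mem_hodgeLieC H e hF hFc
  have hΘ'' : (2 : ℂ) • P - 1 ∈ spanC H.hodgeLie := by rwa [← hodgeLieC_eq_spanC]
  have hYM : Y ∈ spanC 𝔞 := baseChange_mem_spanC hX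
  -- `[P, Y] = E − F`, `[P, E − F] = E + F`
  have hPY : P * Y - Y * P = E - F := by
    rw [hEdef, hFdef, mul_sub (P * Y) 1 P, mul_one, mul_assoc (1 - P) Y P, sub_mul 1 P (Y * P), one_mul,
      ← mul_assoc P Y P]
    abel
  have hPEF : P * (E - F) - (E - F) * P = E + F := by
    rw [mul_sub, sub_mul, hPE, hPF, hEP, hFP, sub_zero, zero_sub, sub_neg_eq_add]
  -- `[P, W] ∈ 𝔞_ℂ` for `W ∈ 𝔞_ℂ`
  have hbr : ∀ W ∈ spanC 𝔞, P * W - W * P ∈ spanC 𝔞 := by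
    intro W hW
    have h := bracket_mem_spanC_of_ideal hI hΘ'' hW
    have h2 : ((2 : ℂ) • P - 1) * W - W * ((2 : ℂ) • P - 1) = (2 : ℂ) • (P * W - W * P) := by
      rw [sub_mul, mul_sub, smul_mul_assoc, mul_smul_comm, one_mul, mul_one, smul_sub]
      abel
    rw [h2] at h
    have h' := (spanC 𝔞).smul_mem (2 : ℂ)⁻¹ h
    rwa [smul_smul, inv_mul_cancel₀ (two_ne_zero' ℂ), one_smul] at h'
  have h1 : E - F ∈ spanC 𝔞 := by rw [← hPY]; exact hbr Y hYM
  have h2 : E + F ∈ spanC 𝔞 := by rw [← hPEF]; exact hbr _ h1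
  have hE2 : E = (2 : ℂ)⁻¹ • ((E - F) + (E + F)) := by
    rw [sub_add_add_cancel, ← two_smul ℂ E, smul_smul, inv_mul_cancel₀ (two_ne_zero' ℂ), one_smul]
  have hF2 : F = (2 : ℂ)⁻¹ • ((E + F) - (E - F)) := by
    rw [add_sub_sub_cancel, ← two_smul ℂ F, smul_smul, inv_mul_cancel₀ (two_ne_zero' ℂ), one_smul]
  constructor
  · rw [hE2]; exact (spanC 𝔞).smul_mem _ ((spanC 𝔞).add_mem h1 h2)
  · rw [hF2]; exact (spanC 𝔞).smul_mem _ ((spanC 𝔞).sub_mem h2 h1)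

/-! ## §2 `𝔞_ℂ = ℂE ⊕ ℂF ⊕ ℂ[E, F]` when `dim_ℚ 𝔞 = 3` -/

/-- **`𝔞_ℂ = ℂE ⊕ ℂF ⊕ ℂ[E, F]`** for a three-dimensional ideal `𝔞 ≤ 𝔥` and `X ∈ 𝔞 ∖ End_Hdg(V)` (weight `1`, degrees
in `{0,1}`, `ψ` a polarization): the three lie in `𝔞_ℂ` (§1 and `bracket_mem_spanC_of_ideal`), are linearly independent
(blocks; `E, F ≠ 0`, `[E, F] ≠ 0` by `projE_ne_zero_of_not_mem_endAlg`, `commutator_projE_projF_ne_zero`), and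
`dim_ℂ 𝔞_ℂ = dim_ℚ 𝔞 = 3`. [cite: FultonHarris1991, Lecture 11 (§11.1)] [cite: MoonenZarhin1999LowDim, §2] -/
theorem exists_coeffs_of_mem_spanC_ideal (H : HodgeStructure V n) (ψ : H.Polarization) (hn : n = 1)
    (e : Module.Basis S ℂ (ℂ ⊗[ℚ] V)) (hF : ∀ a, H.F a = Submodule.span ℂ (e '' {σ | a ≤ deg σ}))
    (hFc : ∀ a, complexConj (H.F a) = Submodule.span ℂ (e '' {σ | deg σ ≤ n - a}))
    (hdeg : ∀ σ, deg σ = 0 ∨ deg σ = 1) {𝔞 : Submodule ℚ (Module.End ℚ V)} (h𝔞 : 𝔞 ≤ H.hodgeLie)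
    (hI : ∀ Z ∈ H.hodgeLie, ∀ X ∈ 𝔞, Z * X - X * Z ∈ 𝔞) (h3 : Module.finrank ℚ 𝔞 = 3)
    {X : Module.End ℚ V} (hX : X ∈ 𝔞) (hXE : X ∉ H.endAlg)
    {D : Module.End ℂ (ℂ ⊗[ℚ] V)} (hD : D ∈ spanC 𝔞) :
    ∃ c : Fin 3 → ℂ, D = c 0 • (gradingEnd e deg * X.baseChange ℂ * (1 - gradingEnd e deg)) +
      c 1 • ((1 - gradingEnd e deg) * X.baseChange ℂ * gradingEnd e deg) +
      c 2 • ((gradingEnd e deg * X.baseChange ℂ * (1 - gradingEnd e deg)) *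
          ((1 - gradingEnd e deg) * X.baseChange ℂ * gradingEnd e deg) -
        ((1 - gradingEnd e deg) * X.baseChange ℂ * gradingEnd e deg) *
          (gradingEnd e deg * X.baseChange ℂ * (1 - gradingEnd e deg))) := by
  classical
  subst hn
  have hX𝔥 : X ∈ H.hodgeLie := h𝔞 hX
  have hcomm0 := commutator_projE_projF_ne_zero H ψ rfl e hF hFc hdeg hX𝔥 hXE
  obtain ⟨hE0, hF0⟩ := projE_ne_zero_of_not_mem_endAlg H rfl e hF hFc hdeg hXE
  obtain ⟨hEd, hFd⟩ := projE_mem_spanC_of_ideal H rfl e hF hFc hdeg hI hX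
  set P := gradingEnd e deg with hP
  set Y := X.baseChange ℂ with hY
  set E := P * Y * (1 - P) with hEdef
  set F := (1 - P) * Y * P with hFdef
  have hPP : P * P = P := gradingEnd_mul_gradingEnd_of_deg e hdeg
  have hPE : P * E = E := by rw [hEdef, ← mul_assoc, ← mul_assoc, hPP]
  have hEP : E * P = 0 := by rw [hEdef, mul_assoc (P * Y) (1 - P) P, sub_mul, one_mul, hPP, sub_self, mul_zero]
  have hPF : P * F = 0 := by
    rw [hFdef, mul_assoc (1 - P) Y P, ← mul_assoc P (1 - P) (Y * P), mul_sub, mul_one, hPP, sub_self, zero_mul]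
  have hFP : F * P = F := by rw [hFdef, mul_assoc ((1 - P) * Y) P P, hPP]
  have hEQ : E * (1 - P) = E := by rw [mul_sub, mul_one, hEP, sub_zero]
  have hQF : (1 - P) * F = F := by rw [sub_mul, one_mul, hPF, sub_zero]
  have hYM : Y ∈ H.hodgeLieC := H.baseChange_mem_hodgeLieC hX𝔥
  obtain ⟨hEM, hFM⟩ := projE_mem_hodgeLieC H e hF hFc hdeg hYM
  rw [← hP, ← hEdef] at hEM
  have hEM' : E ∈ spanC H.hodgeLie := by rwa [← hodgeLieC_eq_spanC]
  have hBd : E * F - F * E ∈ spanC 𝔞 := bracket_mem_spanC_of_ideal hI hEM' hFd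
  -- `[E, F]` commutes with `P`
  have hPB : P * (E * F - F * E) = E * F := by
    rw [mul_sub, ← mul_assoc P E F, ← mul_assoc P F E, hPE, hPF, zero_mul, sub_zero]
  have hBP : (E * F - F * E) * P = E * F := by
    rw [sub_mul, mul_assoc E F P, mul_assoc F E P, hFP, hEP, mul_zero, sub_zero]
  let v : Fin 3 → Module.End ℂ (ℂ ⊗[ℚ] V) := ![E, F, E * F - F * E]
  have hv : ∀ i, v i ∈ spanC 𝔞 := by
    intro i
    fin_cases i
    · exact hEd
    · exact hFd
    · exact hBd
  have hli : LinearIndependent ℂ v := by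
    rw [Fintype.linearIndependent_iff]
    intro g hg
    have hg' : g 0 • E + g 1 • F + g 2 • (E * F - F * E) = 0 := by
      simpa [Fin.sum_univ_three, v] using hg
    have hg0 : g 0 = 0 := by
      have h : P * (g 0 • E + g 1 • F + g 2 • (E * F - F * E)) * (1 - P) = P * 0 * (1 - P) :=
        congrArg (fun T : Module.End ℂ (ℂ ⊗[ℚ] V) => P * T * (1 - P)) hg'
      rw [mul_add, mul_add, add_mul, add_mul, mul_smul_comm, mul_smul_comm, mul_smul_comm, smul_mul_assoc,
        smul_mul_assoc, smul_mul_assoc, hPE, hEQ, hPF, zero_mul, smul_zero, add_zero, hPB, mul_assoc E F (1 - P),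
        mul_sub F 1 P, mul_one, hFP, sub_self, mul_zero, smul_zero, add_zero, mul_zero, zero_mul] at h
      exact (smul_eq_zero.1 h).resolve_right hE0
    rw [hg0, zero_smul, zero_add] at hg'
    have hg1 : g 1 = 0 := by
      have h : (1 - P) * (g 1 • F + g 2 • (E * F - F * E)) * P = (1 - P) * 0 * P :=
        congrArg (fun T : Module.End ℂ (ℂ ⊗[ℚ] V) => (1 - P) * T * P) hg'
      rw [mul_add, add_mul, mul_smul_comm, mul_smul_comm, smul_mul_assoc, smul_mul_assoc, hQF, hFP,
        mul_assoc (1 - P) (E * F - F * E) P, hBP, ← mul_assoc (1 - P) E F, sub_mul 1 P E, one_mul, hPE, sub_self,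
        zero_mul, smul_zero, add_zero, mul_zero, zero_mul] at h
      exact (smul_eq_zero.1 h).resolve_right hF0
    rw [hg1, zero_smul, zero_add] at hg'
    have hg2 : g 2 = 0 := (smul_eq_zero.1 hg').resolve_right hcomm0
    intro i
    fin_cases i
    · exact hg0
    · exact hg1
    · exact hg2
  have hle : Submodule.span ℂ (Set.range v) ≤ spanC 𝔞 := by
    rw [Submodule.span_le]
    rintro _ ⟨i, rfl⟩
    exact hv i
  have hdim : Module.finrank ℂ (spanC 𝔞) ≤ Module.finrank ℂ (Submodule.span ℂ (Set.range v)) := by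
    rw [finrank_span_eq_card hli, Fintype.card_fin]
    unfold spanC
    rw [finrank_span_baseChange_image, h3]
  have heq : Submodule.span ℂ (Set.range v) = spanC 𝔞 := Submodule.eq_of_le_of_finrank_le hle hdim
  have hD' := hD
  rw [← heq, Submodule.mem_span_range_iff_exists_fun] at hD'
  obtain ⟨c, hc⟩ := hD'
  refine ⟨c, ?_⟩
  rw [← hc, Fin.sum_univ_three]
  rfl

/-- **An element of `𝔞_ℂ` commuting with `E` and `F` vanishes** as soon as `E F E = αE` with `α ≠ 0` (three-dimensional
ideal `𝔞 ≤ 𝔥`, `X ∈ 𝔞 ∖ End_Hdg(V)`): writing it `c₀E + c₁F + c₂[E,F]`, the `(1−P)`-corner of its bracket with `E` is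
`c₁ F E` (so `c₁ = 0`, `F E ≠ 0`), its `(+)`-block is `2c₂ EFE = 2c₂αE` (so `c₂ = 0`), and then the bracket with `F`
is `c₀[E, F]` (so `c₀ = 0`).  The centre of `𝔞_ℂ ≅ 𝔰𝔩₂(ℂ)` is trivial. [cite: FultonHarris1991, Lecture 11 (§11.1)]
[cite: MoonenZarhin1999LowDim, §2] -/
theorem eq_zero_of_mem_spanC_ideal_of_commute (H : HodgeStructure V n) (ψ : H.Polarization) (hn : n = 1)
    (e : Module.Basis S ℂ (ℂ ⊗[ℚ] V)) (hF : ∀ a, H.F a = Submodule.span ℂ (e '' {σ | a ≤ deg σ}))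
    (hFc : ∀ a, complexConj (H.F a) = Submodule.span ℂ (e '' {σ | deg σ ≤ n - a}))
    (hdeg : ∀ σ, deg σ = 0 ∨ deg σ = 1) {𝔞 : Submodule ℚ (Module.End ℚ V)} (h𝔞 : 𝔞 ≤ H.hodgeLie)
    (hI : ∀ Z ∈ H.hodgeLie, ∀ X ∈ 𝔞, Z * X - X * Z ∈ 𝔞) (h3 : Module.finrank ℚ 𝔞 = 3)
    {X : Module.End ℚ V} (hX : X ∈ 𝔞) (hXE : X ∉ H.endAlg) {α : ℂ} (hα : α ≠ 0)
    (hEFE : (gradingEnd e deg * X.baseChange ℂ * (1 - gradingEnd e deg)) *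
        ((1 - gradingEnd e deg) * X.baseChange ℂ * gradingEnd e deg) *
        (gradingEnd e deg * X.baseChange ℂ * (1 - gradingEnd e deg)) =
      α • (gradingEnd e deg * X.baseChange ℂ * (1 - gradingEnd e deg)))
    {R : Module.End ℂ (ℂ ⊗[ℚ] V)} (hR : R ∈ spanC 𝔞)
    (hRE : R * (gradingEnd e deg * X.baseChange ℂ * (1 - gradingEnd e deg)) =
      (gradingEnd e deg * X.baseChange ℂ * (1 - gradingEnd e deg)) * R)
    (hRF : R * ((1 - gradingEnd e deg) * X.baseChange ℂ * gradingEnd e deg) =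
      ((1 - gradingEnd e deg) * X.baseChange ℂ * gradingEnd e deg) * R) : R = 0 := by
  classical
  subst hn
  have hX𝔥 : X ∈ H.hodgeLie := h𝔞 hX
  have hcomm0 := commutator_projE_projF_ne_zero H ψ rfl e hF hFc hdeg hX𝔥 hXE
  have hFE0 := projF_mul_projE_ne_zero H ψ rfl e hF hFc hdeg hX𝔥 hXE
  obtain ⟨hE0, hF0⟩ := projE_ne_zero_of_not_mem_endAlg H rfl e hF hFc hdeg hXE
  obtain ⟨c, hc⟩ := exists_coeffs_of_mem_spanC_ideal H ψ rfl e hF hFc hdeg h𝔞 hI h3 hX hXE hR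
  set P := gradingEnd e deg with hP
  set Y := X.baseChange ℂ with hY
  set E := P * Y * (1 - P) with hEdef
  set F := (1 - P) * Y * P with hFdef
  have hPP : P * P = P := gradingEnd_mul_gradingEnd_of_deg e hdeg
  have hPE : P * E = E := by rw [hEdef, ← mul_assoc, ← mul_assoc, hPP]
  have hEP : E * P = 0 := by rw [hEdef, mul_assoc (P * Y) (1 - P) P, sub_mul, one_mul, hPP, sub_self, mul_zero]
  have hPF : P * F = 0 := by
    rw [hFdef, mul_assoc (1 - P) Y P, ← mul_assoc P (1 - P) (Y * P), mul_sub, mul_one, hPP, sub_self, zero_mul]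
  have hFP : F * P = F := by rw [hFdef, mul_assoc ((1 - P) * Y) P P, hPP]
  have hEQ : E * (1 - P) = E := by rw [mul_sub, mul_one, hEP, sub_zero]
  have hQF : (1 - P) * F = F := by rw [sub_mul, one_mul, hPF, sub_zero]
  have hQE : (1 - P) * E = 0 := by rw [sub_mul, one_mul, hPE, sub_self]
  have hFQ : F * (1 - P) = 0 := by rw [mul_sub, mul_one, hFP, sub_self]
  obtain ⟨hEE, hFF⟩ := SL2Triple.mul_self_eq_zero hPE hEP hPF hFP
  set B := E * F - F * E with hBdef
  have hBE : B * E = E * F * E := by rw [hBdef, sub_mul, mul_assoc F E E, hEE, mul_zero, sub_zero]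
  have hEB : E * B = -(E * F * E) := by rw [hBdef, mul_sub, ← mul_assoc E E F, hEE, zero_mul, zero_sub, ← mul_assoc]
  have hBF : B * F = -(F * E * F) := by rw [hBdef, sub_mul, mul_assoc E F F, hFF, mul_zero, zero_sub, mul_assoc]
  have hFB : F * B = F * E * F := by rw [hBdef, mul_sub, ← mul_assoc F F E, hFF, zero_mul, sub_zero, ← mul_assoc]
  -- `[R, E] = 0`: `c₁ = 0` from the `(1−P)`-corner, `c₂ = 0` from the `(+)`-block
  have hRE' : c 1 • (F * E - E * F) + ((2 : ℂ) * c 2 * α) • E = 0 := by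
    have h : R * E - E * R = 0 := sub_eq_zero.2 hRE
    rw [hc] at h
    simp only [add_mul, mul_add, smul_mul_assoc, mul_smul_comm, hEE, hBE, hEB, hEFE, smul_zero, zero_add,
      smul_neg] at h
    rw [← h]
    module
  set Qm : Module.End ℂ (ℂ ⊗[ℚ] V) := 1 - P with hQm
  have cFE : Qm * (F * E) * Qm = F * E := by rw [← mul_assoc Qm F E, hQF, mul_assoc F E Qm, hEQ]
  have cEF : Qm * (E * F) * Qm = 0 := by rw [← mul_assoc Qm E F, hQE, zero_mul, zero_mul]
  have cE : Qm * E * Qm = 0 := by rw [hQE, zero_mul]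
  have hc1 : c 1 = 0 := by
    have h := congrArg (fun T : Module.End ℂ (ℂ ⊗[ℚ] V) => Qm * T * Qm) hRE'
    simp only [smul_sub, mul_add, mul_sub, add_mul, sub_mul, mul_smul_comm, smul_mul_assoc, cFE, cEF, cE,
      smul_zero, sub_zero, add_zero, mul_zero, zero_mul] at h
    exact (smul_eq_zero.1 h).resolve_right hFE0
  have hc2 : c 2 = 0 := by
    rw [hc1, zero_smul, zero_add] at hRE'
    have h := (smul_eq_zero.1 hRE').resolve_right hE0
    have h' : (2 : ℂ) * c 2 = 0 := (mul_eq_zero.1 h).resolve_right hα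
    exact (mul_eq_zero.1 h').resolve_left (two_ne_zero' ℂ)
  rw [hc1, hc2, zero_smul, zero_smul, add_zero, add_zero] at hc
  -- `[R, F] = c₀ [E, F] = 0`
  have hc0 : c 0 = 0 := by
    have h : R * F - F * R = 0 := sub_eq_zero.2 hRF
    rw [hc, smul_mul_assoc, mul_smul_comm] at h
    have h' : c 0 • (E * F - F * E) = 0 := by rw [smul_sub]; exact h
    exact (smul_eq_zero.1 h').resolve_right hcomm0
  rw [hc, hc0, zero_smul]

end HodgeStructure

end Literature.AlgebraicGeometry.Motives

end
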